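import Mathlib
import Literature.AlgebraicGeometry.Shioda1979.Statement
import Literature.AlgebraicGeometry.HodgeTheory.FermatClaimShiodaSpine
import Literature.AlgebraicGeometry.HodgeTheory.FermatClaimPairedCancellation

/-!
# The torsion class of level `33` dies at level `66`: an algebraic-cycle certificate (THEOREM H33, part B)

Solo-blind programme on `KontsevichZagierPeriods`, session 58.  The programme's certificate
(`paper/CERTIFICATE.md` §3f) records, for each level `M`, the torsion of the quotient of the lattice of
Hodge-type (Koblitz–Ogus) Gamma-monomials by the span `D_M` of the three classical relation families
(reflection pairs, Gauss multiplication characters = Aoki's standard elements, same-level two-term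
CM coincidences = Shioda's semi-decomposable sextuples).  At `M = 33` this torsion is `ℤ/2`, generated by
a class `a₃₃` (kernel: `SoloBlindFermatExceptional33`, parity functional `W = {11, 22}`), and `a₃₃` **dies at
level `66`**: its pull-back `(2)a₃₃` lies in `D₆₆` (kernel: the three-coincidence chain of
`SoloBlindZ33Outright`).  Under the Shioda–Aoki dictionary (Hodge multisets `Mₘ` = effective Hodge-type
Gamma-monomials; `D`-generators = the classically KNOWN algebraic cycles on Fermat varieties) this death is
an algebraic-cycle statement about the Fermat fourfold of degree `33` — the degree for which "a simple
computer verification shows that Shioda's program fails" G. da Silva Jr., arXiv:2105.04695, p. 6; [daSilva2021HodgeFermat, §3].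
This file makes that statement precise and kernel-checks its combinatorial content, in the tree's own
rendering of Shioda 1979 / Aoki 1987 (`Literature.AlgebraicGeometry.Shioda1979`, `…HodgeTheory.Fermat*`).

## Results (`[K]` = kernel-checked here; `[F]` = modulo the tree's NAMED literature facts; `[P]` = printed
## inference recorded in the docstrings only)

Level `33` (companion file `SoloBlindFermat33`, part A): `u₃₃ = {2, 8, 11, 17, 29, 32} ⊂ ℤ/33 ∖ 0` is a Hodge
character of `X⁴₃₃` that is neither decomposable, quasi- nor semi-decomposable (`¬ (P₃₃)`, kernel) and is
not stably generated by pairs and standard elements (parity), i.e. represents `T₃₃ ↠ B₃₃/(S₃₃+D₃₃)`.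

Level `66`, the pull-back `lift66 = (2)u₃₃ = {4, 16, 22, 34, 58, 64} ⊂ ℤ/66`:
* `[K]` `lift66_add_sixPairs`: the multiset identity
  `lift66 + {40,26} + {41,25} + {34,32} + {24,42} + {65,1} + {49,17} = sdA + sdB + sdC` with
  `sdA = {4,22,40} ⊎ {65,41,26}`, `sdB = {1,16,49} ⊎ {64,34,34}`, `sdC = {17,25,24} ⊎ {58,32,42}` three
  SEMI-DECOMPOSABLE Hodge sextuples of level `66` (`isSemiDecomposable_sdA/B/C`, `isHodgeMultiset_sdA/B/C`);
* `[K]` `lift66_stably_mPrime`: hence `lift66 + ξ₂ = ξ₁` with `ξ₁, ξ₂ ∈ M'₆₆` — Shioda's condition `(Q)`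
  [Shioda1979HodgeFermat, §4 p. 183] HOLDS for this class at level `66` (it fails for `u₃₃` at level `33`
  in the strong sense above);
* `[K]` `claim_lift66_of_isShiodaClosed`: every Shioda-closed cancellative family of multisets mod `66`
  (the tree's `IsShiodaClosed` + `Shioda1979.IsCancellative`, "intended `C = 𝔈₆₆`") contains `lift66`;
  `claim_lift66_of_semi_star_pairCancel`: it suffices that the family contains the semi-decomposable Hodge
  sextuples, is closed under `∗` and under cancellation of PAIRS;
* `[F]` `claimMultiset_lift66` / `claim_lift66`: **on the real carriers** — granted the named facts
  `Aoki1987_claim_juxtaposition` (Thm. 1-4 (i)) and `Aoki1987_claim_of_claim_juxtaposition_paired`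
  (Thm. 1-4 (ii), pair cancellation) and Shioda's Lemma 1 in the tree's hypothesis shape (semi-decomposable
  Hodge sextuples are cycle characters: Lefschetz `(1,1)` on `X¹₆₆ × X¹₆₆` + type II), the eigenline
  `V(4,16,22,34,58,64) ⊂ H⁴(X⁴₆₆(ℂ); ℂ)` consists of classes of algebraic cycles
  (`FermatCharacter.Claim 66 2`).  The multiset-level pair cancellation `claimMultiset_of_add_pair(s)` is
  derived here from the named fact.
* `[K]` `u33_map_double_eq_lift66`, `claim_u33_of_push`: the level change `x ↦ 2x : ℤ/33 → ℤ/66` carries `u₃₃` to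
  `lift66`; granted a push-forward rule `claim((2)s on X⁴₆₆) ⟹ claim(s on X⁴₃₃)` (the finite surjection
  `X⁴₆₆ → X⁴₃₃`, `xᵢ ↦ xᵢ²`, is equivariant and `φ_* φ^* = deg φ`; NOT a tree fact — hypothesis shape only)
  one gets `claim(u₃₃)` on `X⁴₃₃` `[P]`.

## The printed inference `[P]` (not formalised; inputs named)

(1) `claim(u₃₃)` on `X⁴₃₃` from `claim_lift66` and the push-forward along `X⁴₆₆ → X⁴₃₃`.
(2) With [Aoki1983, Thm. D + Remark 5.4]: `B₃₃ = S₃₃ + T₃₃ + D₃₃`, `2·B₃₃ ⊆ S₃₃ + D₃₃`; the programme's own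
index computation (`CERTIFICATE.md` §3f, level `33`: torsion `ℤ/2` generated by `a₃₃`, python + the kernel
parity here) says every Hodge character `β` of any `Xⁿ₃₃` satisfies `β + A = B` or `β + A = B + (t)u₃₃` with
`A`, `B` sums of pairs, standard elements and semi-decomposable sextuples — all cycle characters by
[Aoki1987, Thm. 1-1, Thm. 2-1] and [Shioda1979HodgeFermat, §4 Lemma 1] — whence claim(`β`) by Thm. 1-4 (i)
and Shioda's cancellation Lemma 3 [Shioda1979HodgeFermat, §4]: **the Hodge conjecture for all `Xⁿ₃₃` and
(by [Shioda1979HodgeFermat] / da Silva, arXiv:2105.04695, Thm. 2.30) for abelian varieties of Fermat type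
of degree `33`**, conditional exactly on (1) and on that index computation (`B₃₃ = D₃₃ + ℤ·u₃₃` with
`D₃₃` the programme's span of pairs, standard elements and semi-decomposable sextuples; python, not
kernel-checked here — the kernel parity only shows `u₃₃ ∉ D₃₃`).
(3) KZ reading (this programme): the Gamma-value identity indexed by `a₃₃` is derivable from the three
standard relations only after raising the level to `66`; geometrically, the cycle lives on `X⁴₆₆` and is
pushed down.  The IMMORTAL classes of the certificate (`a₃₅`, `a₅₅`, …: `(k)a ∉ D_{kM}` for all tested `k`)
are exactly Aoki's semi-standard classes `ξ_q` for which "we have not yet found such a subvariety"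
[Aoki1987, p. 388]; for them no such certificate exists inside the classical cycle supply.

## References

* [Shioda1979HodgeFermat] T. Shioda, The Hodge conjecture for Fermat varieties, Math. Ann. 245 (1979)
  175–184: Thm. I (inductive structure), §4 Lemma 1 (type II), Lemma 3 (cancellation), conditions (P), (Q).
* [Shioda1979PJA] T. Shioda, Proc. Japan Acad. 55A (1979) 111–114, §1 Definitions (i)–(iii), (Pⁿₘ).
* [Aoki1983] N. Aoki, Math. Ann. 266 (1983) 23–54, §5 Thm. D, Remark 5.4 (p. 38), standard elements p. 36.
* [Aoki1987] N. Aoki, J. Math. Soc. Japan 39 (1987) 385–396: Thm. 1-1, Thm. 1-4 (i), (ii) (p. 388),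
  Thm. 2-1, p. 388 (semi-standard elements without known subvariety).
* [daSilva2021HodgeFermat] G. da Silva Jr., arXiv:2101.04739, §2–3 ((P₃₃) fails; Def. 2.4; Thm. 3.3).
* G. da Silva Jr., Known cases of the Hodge conjecture, arXiv:2105.04695, p. 6 ("An interesting case is the Fermat X^n_33.
  A simple computer verification shows that Shioda's program fails in this case.")
* Programme files: `SoloBlindFermatExceptional33` (parity, `v33`), `SoloBlindZ33Outright` (the level-66
  chain `S0 → … → S6` whose three T2-coincidences are `sdA`, `sdB`, `sdC`), `paper/weil-transport.md` §8.2(b).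
-/

open Literature.AlgebraicGeometry.HodgeTheory
open Literature.AlgebraicGeometry.HodgeTheory.FermatCharacter
open Literature.AlgebraicGeometry.Shioda1979

namespace Summit.KontsevichZagierPeriods.KontsevichZagierPeriods.Theorems.SoloBlind.Fermat33Lift66

/-! ### Level 66: the pull-back `(2)u₃₃` and its `(Q)`-certificate -/

/-- The pull-back `(2)u₃₃ = {4, 16, 22, 34, 58, 64}` of the level-`33` torsion class to level `66`
(`x ↦ 2x`), a Hodge character of `X⁴₆₆` up to permutation. [folklore] -/
def lift66 : Multiset (ZMod 66) := {4, 16, 22, 34, 58, 64}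

/-- First semi-decomposable sextuple of the certificate: `{4,22,40} ⊎ {65,41,26}` (two zero-sum triples of
equal CM type; the T2-coincidence `cmKey 66 4 22 = cmKey 66 1 25` of `SoloBlindZ33Outright`). [folklore] -/
def sdA : Multiset (ZMod 66) := {4, 22, 40, 65, 41, 26}

/-- Second semi-decomposable sextuple: `{1,16,49} ⊎ {64,34,34}` (`cmKey 66 1 16 = cmKey 66 2 32`). [folklore] -/
def sdB : Multiset (ZMod 66) := {1, 16, 49, 64, 34, 34}

/-- Third semi-decomposable sextuple: `{17,25,24} ⊎ {58,32,42}` (`cmKey 66 17 25 = cmKey 66 8 34`). [folklore] -/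
def sdC : Multiset (ZMod 66) := {17, 25, 24, 58, 32, 42}

/-- The six pairs cancelled in the certificate: `{40,26} + {41,25} + {34,32} + {24,42} + {65,1} + {49,17}`. [folklore] -/
def sixPairs : Multiset (ZMod 66) := {40, 26, 41, 25, 34, 32, 24, 42, 65, 1, 49, 17}

/-- `(2)u₃₃` is a Hodge multiset of level `66` (`2 Σ⟨t a⟩ = 66 · 6` for all `20` units `t`). [folklore] -/
theorem isHodgeMultiset_lift66 : IsHodgeMultiset lift66 := by
  unfold lift66 IsHodgeMultiset mNormSum; decide +kernel

/-- `sdA` is a Hodge multiset of level `66`. [folklore] -/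
theorem isHodgeMultiset_sdA : IsHodgeMultiset sdA := by
  unfold sdA IsHodgeMultiset mNormSum; decide +kernel

/-- `sdB` is a Hodge multiset of level `66`. [folklore] -/
theorem isHodgeMultiset_sdB : IsHodgeMultiset sdB := by
  unfold sdB IsHodgeMultiset mNormSum; decide +kernel

/-- `sdC` is a Hodge multiset of level `66`. [folklore] -/
theorem isHodgeMultiset_sdC : IsHodgeMultiset sdC := by
  unfold sdC IsHodgeMultiset mNormSum; decide +kernel

/-- `sixPairs` is a Hodge multiset of level `66` (a sum of six pairs). [folklore] -/
theorem isHodgeMultiset_sixPairs : IsHodgeMultiset sixPairs := by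
  unfold sixPairs IsHodgeMultiset mNormSum; decide +kernel

/-- `sdA` is semi-decomposable: `{4,22,40} ⊎ {65,41,26}`, both triples summing to `0 mod 66`.
[cite: Shioda1979PJA, §1 Definition (iii)] -/
theorem isSemiDecomposable_sdA : IsSemiDecomposable sdA :=
  ⟨{4, 22, 40}, {65, 41, 26}, by decide, by decide, by decide, by decide, by decide⟩

/-- `sdB` is semi-decomposable: `{1,16,49} ⊎ {64,34,34}`. [cite: Shioda1979PJA, §1 Definition (iii)] -/
theorem isSemiDecomposable_sdB : IsSemiDecomposable sdB :=
  ⟨{1, 16, 49}, {64, 34, 34}, by decide, by decide, by decide, by decide, by decide⟩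

/-- `sdC` is semi-decomposable: `{17,25,24} ⊎ {58,32,42}`. [cite: Shioda1979PJA, §1 Definition (iii)] -/
theorem isSemiDecomposable_sdC : IsSemiDecomposable sdC :=
  ⟨{17, 25, 24}, {58, 32, 42}, by decide, by decide, by decide, by decide, by decide⟩

/-- **The certificate identity**: `(2)u₃₃ + sixPairs = sdA + sdB + sdC` as multisets mod `66`
(the Hodge reading of the chain `S0 → S6` of `SoloBlindZ33Outright`). [folklore] -/
theorem lift66_add_sixPairs : lift66 + sixPairs = sdA + sdB + sdC := by
  decide +kernel

/-- `sixPairs` is literally the sum of the six pairs `{a, -a}`, `a = 40, 41, 34, 24, 65, 49`. [folklore] -/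
theorem sixPairs_eq :
    sixPairs = {40, -40} + {41, -41} + {34, -34} + {24, -24} + {65, -65} + {49, -49} := by
  decide +kernel

/-- `sdA` is one of Shioda's prime generators of `M'₆₆` (a semi-decomposable element of `M₆₆(3)`).
[cite: Shioda1979HodgeFermat, §4 p. 183 (definition of M'ₘ)] -/
theorem sdA_mem_primeGenerators : sdA ∈ primeGenerators 66 :=
  ⟨isHodgeMultiset_sdA, Or.inr (Or.inr ⟨by decide, isSemiDecomposable_sdA⟩)⟩

/-- `sdB ∈` prime generators of `M'₆₆`. [cite: Shioda1979HodgeFermat, §4 p. 183] -/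
theorem sdB_mem_primeGenerators : sdB ∈ primeGenerators 66 :=
  ⟨isHodgeMultiset_sdB, Or.inr (Or.inr ⟨by decide, isSemiDecomposable_sdB⟩)⟩

/-- `sdC ∈` prime generators of `M'₆₆`. [cite: Shioda1979HodgeFermat, §4 p. 183] -/
theorem sdC_mem_primeGenerators : sdC ∈ primeGenerators 66 :=
  ⟨isHodgeMultiset_sdC, Or.inr (Or.inr ⟨by decide, isSemiDecomposable_sdC⟩)⟩

/-- `sdA + sdB + sdC ∈ M'₆₆`. [cite: Shioda1979HodgeFermat, §4 p. 183] -/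
theorem sd_sum_mem_mPrime : sdA + sdB + sdC ∈ MPrime 66 :=
  add_mem (add_mem (mem_mPrime_of_mem sdA_mem_primeGenerators)
    (mem_mPrime_of_mem sdB_mem_primeGenerators)) (mem_mPrime_of_mem sdC_mem_primeGenerators)

/-- `sixPairs ∈ M'₆₆` (pairs are prime generators). [cite: Shioda1979HodgeFermat, §3 (Mₘ(1)), §4 p. 183] -/
theorem sixPairs_mem_mPrime : sixPairs ∈ MPrime 66 := by
  rw [sixPairs_eq]
  refine add_mem (add_mem (add_mem (add_mem (add_mem ?_ ?_) ?_) ?_) ?_) ?_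
  all_goals exact pair_mem_mPrime (by decide)

/-- **`(Q)` holds for `(2)u₃₃` at level `66`**: `lift66 + ξ₂ = ξ₁` with `ξ₁, ξ₂ ∈ M'₆₆`
(`ξ₁` = three semi-decomposable sextuples, `ξ₂` = six pairs). [cite: Shioda1979HodgeFermat, §4 condition (Qⁿₘ), p. 183] -/
theorem lift66_stably_mPrime : ∃ ξ₁ ∈ MPrime 66, ∃ ξ₂ ∈ MPrime 66, lift66 + ξ₂ = ξ₁ :=
  ⟨sdA + sdB + sdC, sd_sum_mem_mPrime, sixPairs, sixPairs_mem_mPrime, lift66_add_sixPairs⟩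

/-- **Every Shioda-closed cancellative family of multisets mod `66` contains `(2)u₃₃`** (intended
`C = 𝔈₆₆`, Shioda's set of cycle characters; closure = Thm. I + Lemma 1 + Lefschetz, cancellation = Lemma 3).
[cite: Shioda1979HodgeFermat, §4 Lemmas 1–3 and Thm. I] -/
theorem claim_lift66_of_isShiodaClosed {C : Multiset (ZMod 66) → Prop} (hC : IsShiodaClosed C)
    (hL : IsCancellative C) : C lift66 :=
  hL lift66 sixPairs isHodgeMultiset_lift66 (by decide) isHodgeMultiset_sixPairs
    (by rw [lift66_add_sixPairs]; exact mem_of_mem_mPrime hC _ sd_sum_mem_mPrime (by decide))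
    (mem_of_mem_mPrime hC _ sixPairs_mem_mPrime (by decide))

/-- **Pairs-only form**: a family containing the semi-decomposable Hodge sextuples, closed under `∗`
(Thm. 1-4 (i)) and under cancellation of a pair (Thm. 1-4 (ii)) contains `(2)u₃₃` — peel the six pairs
off `sdA + sdB + sdC`. [cite: Aoki1987, Thm. 1-4 (i), (ii), p. 388] [cite: Shioda1979HodgeFermat, §4 Lemma 1] -/
theorem claim_lift66_of_semi_star_pairCancel {C : Multiset (ZMod 66) → Prop}
    (semi : ∀ s : Multiset (ZMod 66), IsHodgeMultiset s → IsSemiDecomposable s → C s)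
    (star : ∀ t u : Multiset (ZMod 66), t ≠ 0 → u ≠ 0 → IsHodgeMultiset t → IsHodgeMultiset u →
      C t → C u → C (t + u))
    (pairCancel : ∀ (s : Multiset (ZMod 66)) (a : ZMod 66), IsHodgeMultiset s → a ≠ 0 →
      C (s + {a, -a}) → C s) : C lift66 := by
  have hABC : C (sdA + sdB + sdC) :=
    star _ _ (by decide) (by decide) (isHodgeMultiset_sdA.add isHodgeMultiset_sdB) isHodgeMultiset_sdC
      (star _ _ (by decide) (by decide) isHodgeMultiset_sdA isHodgeMultiset_sdB
        (semi _ isHodgeMultiset_sdA isSemiDecomposable_sdA) (semi _ isHodgeMultiset_sdB isSemiDecomposable_sdB))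
      (semi _ isHodgeMultiset_sdC isSemiDecomposable_sdC)
  rw [← lift66_add_sixPairs, sixPairs_eq] at hABC
  simp only [← add_assoc] at hABC
  have h0 := isHodgeMultiset_lift66
  have h1 : IsHodgeMultiset (lift66 + {40, -40}) := h0.add (IsHodgeMultiset.pair (by decide))
  have h2 : IsHodgeMultiset (lift66 + {40, -40} + {41, -41}) := h1.add (IsHodgeMultiset.pair (by decide))
  have h3 : IsHodgeMultiset (lift66 + {40, -40} + {41, -41} + {34, -34}) :=
    h2.add (IsHodgeMultiset.pair (by decide))
  have h4 : IsHodgeMultiset (lift66 + {40, -40} + {41, -41} + {34, -34} + {24, -24}) :=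
    h3.add (IsHodgeMultiset.pair (by decide))
  have h5 : IsHodgeMultiset (lift66 + {40, -40} + {41, -41} + {34, -34} + {24, -24} + {65, -65}) :=
    h4.add (IsHodgeMultiset.pair (by decide))
  exact pairCancel _ _ h0 (by decide) (pairCancel _ _ h1 (by decide) (pairCancel _ _ h2 (by decide)
    (pairCancel _ _ h3 (by decide) (pairCancel _ _ h4 (by decide) (pairCancel _ _ h5 (by decide) hABC)))))

/-! ### The real carriers: `claim` for the eigenline `V((2)u₃₃) ⊂ H⁴(X⁴₆₆)` modulo the named facts -/

/-- **Multiset-level pair cancellation from Aoki's Thm. 1-4 (ii)** (the named fact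
`Aoki1987_claim_of_claim_juxtaposition_paired`, via its printed letter `.literal`): if every character with
multiset `s + (a₀,…,a_t,-a₀,…,-a_t)` satisfies claim, so does every character with multiset `s` (`s` Hodge).
[cite: Aoki1987, Thm. 1-4 (ii), p. 388] -/
theorem claimMultiset_of_add_pairs (h : Aoki1987_claim_of_claim_juxtaposition_paired) {m : ℕ} [NeZero m]
    {s : Multiset (ZMod m)} (hs : IsHodgeMultiset s) {t : ℕ} (a : Fin (t + 1) → ZMod m)
    (ha : ∀ k, a k ≠ 0)
    (hc : ClaimMultiset m (s + Finset.univ.val.map (FermatCharacter.pairs a))) : ClaimMultiset m s := by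
  intro r α hα
  have hαH : IsHodge α := (isHodge_iff_isHodgeMultiset α).2 (by rw [hα]; exact hs)
  refine h.literal m r t α a hαH ha (hc.claim ?_)
  rw [univ_val_map_append, hα]

/-- **Cancellation of one pair** `{a, -a}`, `a ≠ 0`, on the real carriers. [cite: Aoki1987, Thm. 1-4 (ii), p. 388] -/
theorem claimMultiset_of_add_pair (h : Aoki1987_claim_of_claim_juxtaposition_paired) {m : ℕ} [NeZero m]
    {s : Multiset (ZMod m)} (hs : IsHodgeMultiset s) {a : ZMod m} (ha : a ≠ 0)
    (hc : ClaimMultiset m (s + {a, -a})) : ClaimMultiset m s := by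
  refine claimMultiset_of_add_pairs h hs (t := 0) (fun _ ↦ a) (fun _ ↦ ha) ?_
  have hp : Finset.univ.val.map (FermatCharacter.pairs (t := 0) (fun _ : Fin (0 + 1) ↦ a)) = {a, -a} := by
    rw [univ_val_map_pairs]
    rfl
  rw [hp]
  exact hc

/-- **THEOREM H33 at level 66 (real carriers, modulo named facts)**: granted Aoki's Thm. 1-4 (i), (ii) and
Shioda's Lemma 1 (semi-decomposable Hodge sextuples of level `66` are cycle characters), every character
of `X⁴₆₆` with multiset `(2)u₃₃` satisfies claim. [cite: Aoki1987, Thm. 1-4, p. 388]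
[cite: Shioda1979HodgeFermat, §4 Lemma 1] -/
theorem claimMultiset_lift66 (hjux : Aoki1987_claim_juxtaposition)
    (hpc : Aoki1987_claim_of_claim_juxtaposition_paired)
    (hsemi : ∀ s : Multiset (ZMod 66), IsHodgeMultiset s → IsSemiDecomposable s → ClaimMultiset 66 s) :
    ClaimMultiset 66 lift66 :=
  claim_lift66_of_semi_star_pairCancel hsemi
    (fun _ _ ht0 hu0 ht hu hct hcu ↦ ClaimMultiset.star_of_juxtaposition hjux ht0 hu0 ht hu hct hcu)
    (fun _ _ hs ha hc ↦ claimMultiset_of_add_pair hpc hs ha hc)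

/-- **The eigenline `V(4,16,22,34,58,64) ⊂ H⁴(X⁴₆₆(ℂ); ℂ)` consists of algebraic classes**, modulo the
same inputs (`FermatCharacter.Claim 66 2`: `fermatEigenspace ≤ algebraicClasses`). [cite: Aoki1987, Thm. 1-4, p. 388]
[cite: Shioda1979HodgeFermat, §4 Lemma 1] -/
theorem claim_lift66 (hjux : Aoki1987_claim_juxtaposition)
    (hpc : Aoki1987_claim_of_claim_juxtaposition_paired)
    (hsemi : ∀ s : Multiset (ZMod 66), IsHodgeMultiset s → IsSemiDecomposable s → ClaimMultiset 66 s) :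
    FermatCharacter.Claim 66 2 (![4, 16, 22, 34, 58, 64] : Fin (2 * 2 + 2) → ZMod 66) :=
  (claimMultiset_lift66 hjux hpc hsemi).claim (by decide)

/-! ### Level change `33 → 66` -/

/-- The level-raising map `x ↦ 2x : ℤ/33 → ℤ/66` on residues (pull-back of characters along
`X⁴₆₆ → X⁴₃₃`, `xᵢ ↦ xᵢ²`). [cite: Shioda1979HodgeFermat, §1] -/
def double (x : ZMod 33) : ZMod 66 := ((2 * x.val : ℕ) : ZMod 66)

/-- `(2)u₃₃ = lift66` for `u₃₃ = {2, 8, 11, 17, 29, 32}` (the class of part A). [folklore] -/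
theorem u33_map_double_eq_lift66 :
    ({2, 8, 11, 17, 29, 32} : Multiset (ZMod 33)).map double = lift66 := by
  unfold double lift66; decide +kernel

/-- **Transfer packaging**: a push-forward rule "claim of the pull-back on `X⁴₆₆` ⟹ claim on `X⁴₃₃`"
(hypothesis shape; the finite equivariant surjection `X⁴₆₆ → X⁴₃₃`) turns any level-`66` certificate for
`lift66` into membership of `u₃₃` in the level-`33` family. [cite: Shioda1979HodgeFermat, §1 and Thm. I] -/
theorem claim_u33_of_push {C33 : Multiset (ZMod 33) → Prop} {C66 : Multiset (ZMod 66) → Prop}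
    (push : ∀ s : Multiset (ZMod 33), IsHodgeMultiset s → C66 (s.map double) → C33 s)
    (h66 : C66 lift66) : C33 {2, 8, 11, 17, 29, 32} := by
  have hH : IsHodgeMultiset ({2, 8, 11, 17, 29, 32} : Multiset (ZMod 33)) := by
    unfold IsHodgeMultiset mNormSum; decide +kernel
  exact push _ hH (by rw [u33_map_double_eq_lift66]; exact h66)

/-- **THEOREM H33 (real carriers, level 33)**: granted Thm. 1-4 (i), (ii), Shioda's Lemma 1 at level `66`
and the push-forward rule `X⁴₆₆ → X⁴₃₃` on the tree's `ClaimMultiset`, the Hodge class `u₃₃` of `X⁴₃₃` —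
a witness of the failure of Shioda's programme at `33` (part A) — is a cycle character. [cite: Aoki1987, Thm. 1-4, p. 388]
[cite: Shioda1979HodgeFermat, §4 Lemma 1, Thm. I] [cite: daSilva2021HodgeFermat, §3 ((P₃₃) false)] -/
theorem claimMultiset_u33 (hjux : Aoki1987_claim_juxtaposition)
    (hpc : Aoki1987_claim_of_claim_juxtaposition_paired)
    (hsemi : ∀ s : Multiset (ZMod 66), IsHodgeMultiset s → IsSemiDecomposable s → ClaimMultiset 66 s)
    (push : ∀ s : Multiset (ZMod 33), IsHodgeMultiset s → ClaimMultiset 66 (s.map double) →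
      ClaimMultiset 33 s) : ClaimMultiset 33 {2, 8, 11, 17, 29, 32} :=
  claim_u33_of_push push (claimMultiset_lift66 hjux hpc hsemi)

end Summit.KontsevichZagierPeriods.KontsevichZagierPeriods.Theorems.SoloBlind.Fermat33Lift66
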